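import Literature.AlgebraicGeometry.HodgeTheory.CMHodgeGroupCentre
import HarnessLib

/-!
# The centre of `Lie Hg` for a CM field, II: two unbalanced places — an unbalanced two-valued Hodge endomorphism is
# impossible, so the obstruction `y` is CM-quadratic and is excluded by «no Weil-type quadratic subfield»
# (Moonen–Zarhin 1999 §1–2, (2.3); Ribet 1983 Thm. 0)

Family `hodge`, layer `Literature/AlgebraicGeometry/HodgeTheory` (brick P4′ of the design note
`HOME/jobs/A7-inventory-eng5g6/DESIGN-rows10-12-allmembers.md` of the cell `pub-hodgeav-hg6`, req-37 (A) Q2b, TABLE X rows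
10 / 12 ALL MEMBERS; continues `CMHodgeGroupCentre`). UNCONDITIONAL; theorems only, no definition, no named fact, no `sorry`.
HONEST FRAMING of that cell: HC / HC_AV / HC_CM / H2 NOT proved — linear algebra of polarized weight-one Hodge structures.

* §1 `CMArith.linearIndependent_baseChange` — `ℚ`-linearly independent endomorphisms of `V` have `ℂ`-linearly independent
  base changes (from the tree's `finrank_spanC_eq`, i.e. flatness of `ℂ/ℚ`; universe-polymorphic form).
* §2 **`CMArith.false_of_two_eigenvalues`** — UNBALANCED TWO-VALUED IS IMPOSSIBLE: if `End_Hdg(V) = E` has all non-zero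
  elements invertible (`hdiv`) and `u ∈ E` acts on a basis of `V_ℂ` with exactly two values `a ≠ c` of DIFFERENT
  multiplicities, contradiction: `(u_ℂ − a)(u_ℂ − c) = 0` makes `1, u, u²` dependent over `ℂ`, hence over `ℚ` (§1), so
  `a + c ∈ ℚ`; with `Tr(u) = m_a a + m_c c ∈ ℚ` and `m_a ≠ m_c` this gives `a ∈ ℚ`, and a rational eigenvalue forces
  `u = a · 1` (`CMArith.eq_smul_one_of_apply_eq_smul`). (The characteristic polynomial of `u` is a power of its minimal
  polynomial: «`V` is free over the field `ℚ(u)`».)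
* §3 `CMThetaCentre.trace_baseChange_mul_theta` — `Tr(y_ℂ Θ) = 2 Σ_k σ_k(y) (dim W_{μ k}^{1,0} − dim W_{μ k}^{0,1})` for a
  `ψ`-skew `y ∈ E`.
* §4 **`CMThetaCentre.centre_of_pair`** — CENTRE for the patterns with exactly TWO unbalanced places `k₁ ≠ k₂` of equal
  weight `|dim W^{1,0} − dim W^{0,1}|` (row 12: `(n_σ) = (2,2,1)`/`(2,0,1)`; row 10: `(2,2)`/`(2,1)`), `|ι| ≠ 4`, under the
  hypothesis «NO WEIL-TYPE QUADRATIC ELEMENT»: every non-zero `ψ`-skew `y ∈ E` with `y² ∈ ℚ · 1` has `Tr(y_ℂ Θ) ≠ 0` (for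
  `k = ℚ(y)` imaginary quadratic this says that the `k`-signature of `V^{1,0}` is not `(g/2, g/2)`). PROOF: the obstruction
  `y` of `CMThetaCentre.centre_or_exists_skew` has `σ_{k₂}(y) = ±σ_{k₁}(y)`, so `u = y²` takes the value `σ_{k₁}(y)²` on the
  `4n₀` basis vectors over `k₁, k₂` (skew transfer) and `σ_k(y)²` over each other place: by §2 all these values coincide, so
  `y² ∈ ℚ · 1`, and `Tr(y_ℂ Θ) = 0` contradicts the hypothesis.

## References
* [MoonenZarhin1999LowDim] B. Moonen, Yu. Zarhin, Math. Ann. 315 (1999), §1 (1.8), §2 (2.3) (the Weil-type exception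
  `k ⊂ F` with multiplicities `(n/2, n/2)`).
* [Ribet1983] K. A. Ribet, Amer. J. Math. 105 (1983), Thm. 0, §3.
* [Deligne1982HodgeCycles] P. Deligne, LNM 900 (1982), I §3 (proof of Prop. 3.4), §4 (p. 30).
-/

noncomputable section

open scoped TensorProduct
open Module

namespace Literature.AlgebraicGeometry.Motives

namespace HodgeStructure

universe u

variable {V : Type u} [AddCommGroup V] [Module ℚ V] {n : ℤ}

/-- Rational scalars act on `V_ℂ` through `ℚ ⊆ ℂ`. [folklore] -/
private theorem CMWeil.ratCast_smul (q : ℚ) (z : ℂ ⊗[ℚ] V) : (q : ℂ) • z = q • z := by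
  rw [← algebraMap_smul ℂ q z, eq_ratCast]

/-! ### §1 Independence under base change -/

/-- **`ℚ`-linearly independent endomorphisms have `ℂ`-linearly independent base changes** (flatness of `ℂ/ℚ`, through the
tree's `finrank_spanC_eq`). [cite: Deligne1982HodgeCycles, I §3 (proof of Prop. 3.4)] -/
theorem CMArith.linearIndependent_baseChange [Module.Finite ℚ V] {κ : Type*} [Fintype κ] {a : κ → Module.End ℚ V}
    (ha : LinearIndependent ℚ a) : LinearIndependent ℂ fun i => (a i).baseChange ℂ := by
  classical
  set S : Submodule ℚ (Module.End ℚ V) := Submodule.span ℚ (Set.range a) with hS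
  have key : ∀ x ∈ S, x.baseChange ℂ ∈ Submodule.span ℂ (Set.range fun i => (a i).baseChange ℂ) := by
    intro x hx
    rw [hS] at hx
    induction hx using Submodule.span_induction with
    | mem y hy =>
      obtain ⟨i, rfl⟩ := hy
      exact Submodule.subset_span ⟨i, rfl⟩
    | zero => rw [LinearMap.baseChange_zero]; exact Submodule.zero_mem _
    | add y z _ _ hy hz => rw [LinearMap.baseChange_add]; exact Submodule.add_mem _ hy hz
    | smul q y _ hy =>
      rw [LinearMap.baseChange_smul]
      have h : q • (y.baseChange ℂ) = (q : ℂ) • y.baseChange ℂ := LinearMap.ext fun w => by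
        rw [LinearMap.smul_apply, LinearMap.smul_apply, CMWeil.ratCast_smul]
      rw [h]
      exact Submodule.smul_mem _ _ hy
  have hSC : spanC S = Submodule.span ℂ (Set.range fun i => (a i).baseChange ℂ) := by
    apply le_antisymm
    · unfold spanC
      refine Submodule.span_le.2 ?_
      rintro _ ⟨x, hx, rfl⟩
      exact key x hx
    · refine Submodule.span_le.2 ?_
      rintro _ ⟨i, rfl⟩
      exact baseChange_mem_spanC (Submodule.subset_span ⟨i, rfl⟩)
  rw [linearIndependent_iff_card_eq_finrank_span, Set.finrank, ← hSC, finrank_spanC_eq, hS, finrank_span_eq_card ha]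

/-! ### §2 An unbalanced two-valued Hodge endomorphism is impossible -/

/-- **UNBALANCED TWO-VALUED IS IMPOSSIBLE** (see the module docstring): `u ∈ End_Hdg(V)` acting on a basis of `V_ℂ` by two
values `a ≠ c` with different multiplicities contradicts `hdiv`. [cite: MoonenZarhin1999LowDim, §1] -/
theorem CMArith.false_of_two_eigenvalues [Module.Finite ℚ V] (H : HodgeStructure V n)
    (hdiv : ∀ a ∈ H.endAlg, a ≠ 0 → ∃ b : Module.End ℚ V, b * a = 1) {u : Module.End ℚ V} (huE : u ∈ H.endAlg)
    {κ : Type*} [Fintype κ] [DecidableEq κ] (b : Module.Basis κ ℂ (ℂ ⊗[ℚ] V)) (s : κ → ℂ)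
    (hu : ∀ i, u.baseChange ℂ (b i) = s i • b i) {a c : ℂ} (hac : a ≠ c) (hs : ∀ i, s i = a ∨ s i = c)
    (hcount : (Finset.univ.filter fun i => s i = a).card ≠ (Finset.univ.filter fun i => s i = c).card)
    (hna : ∃ i, s i = a) (hnc : ∃ i, s i = c) : False := by
  classical
  haveI : Module.Free ℚ V := Module.Free.of_divisionRing ℚ V
  obtain ⟨ia, hia⟩ := hna
  obtain ⟨ic, hic⟩ := hnc
  have hUU : ∀ i, (u * u).baseChange ℂ (b i) = (s i * s i) • b i := fun i => by
    rw [LinearMap.baseChange_mul, Module.End.mul_apply, hu, map_smul, hu, smul_smul]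
  -- a rational scalar `u = q·1` is excluded (it would give `a = q = c`)
  have hnot : ∀ q : ℚ, u ≠ q • 1 := fun q h => by
    have h1 := hu ia
    have h2 := hu ic
    rw [h] at h1 h2
    have e1 : (q : ℂ) • b ia = s ia • b ia := by
      rw [← h1, LinearMap.baseChange_smul, LinearMap.smul_apply, LinearMap.baseChange_one, Module.End.one_apply,
        CMWeil.ratCast_smul]
    have e2 : (q : ℂ) • b ic = s ic • b ic := by
      rw [← h2, LinearMap.baseChange_smul, LinearMap.smul_apply, LinearMap.baseChange_one, Module.End.one_apply,
        CMWeil.ratCast_smul]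
    have e1' : (q : ℂ) = s ia := smul_left_injective ℂ (b.ne_zero ia) e1
    have e2' : (q : ℂ) = s ic := smul_left_injective ℂ (b.ne_zero ic) e2
    exact hac (by rw [← hia, ← hic, ← e1', ← e2'])
  -- `1, u, u²` are `ℚ`-dependent (their base changes satisfy `(U − a)(U − c) = 0`)
  have hdep : ¬ LinearIndependent ℚ ![(1 : Module.End ℚ V), u, u * u] := by
    intro hli
    have hC := Fintype.linearIndependent_iff.1 (CMArith.linearIndependent_baseChange hli) ![a * c, -(a + c), 1]
    have h0 : ∑ i, (![a * c, -(a + c), 1] : Fin 3 → ℂ) i • (![(1 : Module.End ℚ V), u, u * u] i).baseChange ℂ = 0 := by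
      refine b.ext fun j => ?_
      rw [LinearMap.zero_apply, Fin.sum_univ_three]
      simp only [Matrix.cons_val_zero, Matrix.cons_val_one, Matrix.cons_val, LinearMap.add_apply,
        LinearMap.smul_apply, LinearMap.baseChange_one, Module.End.one_apply, hu, hUU, smul_smul, ← add_smul]
      rcases hs j with h | h <;> rw [h] <;> ring_nf <;> rw [zero_smul]
    have := hC h0 2
    simp at this
  obtain ⟨g, hg, i, hi⟩ := Fintype.not_linearIndependent_iff.1 hdep
  rw [Fin.sum_univ_three] at hg
  simp only [Matrix.cons_val_zero, Matrix.cons_val_one, Matrix.cons_val] at hg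
  -- `hg : g 0 • 1 + g 1 • u + g 2 • (u * u) = 0`
  by_cases h2 : g 2 = 0
  · rw [h2, zero_smul, add_zero] at hg
    by_cases h1 : g 1 = 0
    · rw [h1, zero_smul, add_zero] at hg
      have h00 : g 0 = 0 := by
        by_contra h00
        have h := LinearMap.congr_fun (congrArg (LinearMap.baseChange ℂ) hg) (b ia)
        rw [LinearMap.baseChange_smul, LinearMap.smul_apply, LinearMap.baseChange_one, Module.End.one_apply,
          LinearMap.baseChange_zero, LinearMap.zero_apply, smul_eq_zero] at h
        exact h.elim h00 (b.ne_zero ia)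
      apply hi
      fin_cases i
      · exact h00
      · exact h1
      · exact h2
    · refine hnot (-(g 0 / g 1)) ?_
      have h : g 1 • u = -(g 0 • (1 : Module.End ℚ V)) := eq_neg_of_add_eq_zero_right hg
      calc u = (g 1)⁻¹ • (g 1 • u) := by rw [smul_smul, inv_mul_cancel₀ h1, one_smul]
        _ = -(g 0 / g 1) • 1 := by rw [h, smul_neg, smul_smul, neg_smul, div_eq_inv_mul]
  · -- `u² = α u + β` with `α = -(g 1 / g 2)`, hence `a + c = α ∈ ℚ`
    set α : ℚ := -(g 1 / g 2) with hα
    set β : ℚ := -(g 0 / g 2) with hβ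
    have huu : u * u = α • u + β • 1 := by
      have h : g 2 • (u * u) = -(g 0 • 1 + g 1 • u) := eq_neg_of_add_eq_zero_right hg
      calc u * u = (g 2)⁻¹ • (g 2 • (u * u)) := by rw [smul_smul, inv_mul_cancel₀ h2, one_smul]
        _ = α • u + β • 1 := by rw [h, hα, hβ]; module
    have hval : ∀ j, s j * s j = (α : ℂ) * s j + β := fun j => by
      have h := LinearMap.congr_fun (congrArg (LinearMap.baseChange ℂ) huu) (b j)
      rw [hUU, LinearMap.baseChange_add, LinearMap.add_apply, LinearMap.baseChange_smul, LinearMap.baseChange_smul,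
        LinearMap.smul_apply, LinearMap.smul_apply, hu, LinearMap.baseChange_one, Module.End.one_apply,
        ← CMWeil.ratCast_smul, ← CMWeil.ratCast_smul, smul_smul, ← add_smul] at h
      exact smul_left_injective ℂ (b.ne_zero j) h
    have hsum : a + c = α := by
      have h1 := hval ia
      have h2 := hval ic
      rw [hia] at h1
      rw [hic] at h2
      have h3 : (a - c) * (a + c - α) = 0 := by linear_combination h1 - h2
      exact sub_eq_zero.1 ((mul_eq_zero.1 h3).resolve_left (sub_ne_zero.2 hac))
    -- the trace: `m_a a + m_c c = Tr_ℚ(u)`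
    set ma := (Finset.univ.filter fun i => s i = a).card with hma
    set mc := (Finset.univ.filter fun i => s i = c).card with hmc
    have htr : (ma : ℂ) * a + (mc : ℂ) * c = ((LinearMap.trace ℚ V u : ℚ) : ℂ) := by
      rw [← eq_ratCast (algebraMap ℚ ℂ), ← LinearMap.trace_baseChange, CMArith.trace_eq_sum_of_apply_basis b _ s hu,
        ← Finset.sum_filter_add_sum_filter_not Finset.univ (fun i => s i = a)]
      congr 1
      · rw [Finset.sum_congr rfl fun i hi => (Finset.mem_filter.1 hi).2, Finset.sum_const, nsmul_eq_mul]
      · have hfilt : (Finset.univ.filter fun i => ¬ s i = a) = Finset.univ.filter fun i => s i = c := by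
          ext i
          simp only [Finset.mem_filter, Finset.mem_univ, true_and]
          exact ⟨fun h => (hs i).resolve_left h, fun h h' => hac (h'.symm.trans h)⟩
        rw [hfilt, Finset.sum_congr rfl fun i hi => (Finset.mem_filter.1 hi).2, Finset.sum_const, nsmul_eq_mul]
    -- solve for `a`: it is rational
    set r : ℚ := LinearMap.trace ℚ V u with hr
    have hmne : (ma : ℂ) - mc ≠ 0 := by
      rw [sub_ne_zero]; exact_mod_cast hcount
    have haq : a = (((r - mc * α) / (ma - mc) : ℚ) : ℂ) := by
      push_cast
      rw [eq_div_iff hmne]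
      linear_combination htr - (mc : ℂ) * hsum
    -- a rational eigenvalue forces a scalar
    exact hnot _ (CMArith.eq_smul_one_of_apply_eq_smul H hdiv huE (b.ne_zero ia) (by rw [hu, hia, haq]))

/-! ### §3 The trace of `y_ℂ Θ` -/

/-- **`Tr(y_ℂ Θ) = 2 Σ_k σ_k(y) (dim W_{μ k}^{1,0} − dim W_{μ k}^{0,1})`** for a `ψ`-skew Hodge endomorphism `y` acting by
`σ_k` on `W_{μ k}` and an operator `Θ` commuting with `φ_ℂ`, `ψ_ℂ`-skew and equal to `±1` on `V^{1,0}` / `V^{0,1}` (the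
conjugate blocks contribute the same as the `W_{μ k}`, by duality). [cite: MoonenZarhin1999LowDim, §2 (2.3)]
[cite: Deligne1982HodgeCycles, §4 (p. 30)] -/
theorem CMThetaCentre.trace_baseChange_mul_theta [Module.Finite ℚ V] [HodgeTensorFacts.{u, u}] {ι : Type} [Fintype ι]
    [DecidableEq ι] (H : HodgeStructure V n) (hn : n = 1) (heff : H.IsEffective) (ψ : H.Polarization)
    {φ : Module.End ℚ V} (hφE : φ ∈ H.endAlg) {m : ℕ} (hE : ∀ a ∈ H.endAlg, ∃ q : Fin m → ℚ, a = ∑ k, q k • φ ^ (k : ℕ))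
    (μ : ι → ℂ) (hinj : Function.Injective μ) (hdist : ∀ k k', μ k' ≠ starRingEnd ℂ (μ k)) {n₀ : ℕ}
    (hrank : ∀ k, Module.finrank ℂ ↥(Module.End.eigenspace (φ.baseChange ℂ) (μ k) ⊓ H.piece 1 0) +
      Module.finrank ℂ ↥(Module.End.eigenspace (φ.baseChange ℂ) (μ k) ⊓ H.piece 0 1) = n₀)
    (htop : (⨆ kt : ι × Fin 2, Module.End.eigenspace (φ.baseChange ℂ)
      (if kt.2 = 0 then μ kt.1 else starRingEnd ℂ (μ kt.1))) = ⊤)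
    {Θ : Module.End ℂ (ℂ ⊗[ℚ] V)} (hΘ : ∀ p, ∀ x ∈ H.piece p (n - p), Θ x = ((2 * p - n : ℤ) : ℂ) • x)
    (hΘφ : Θ * φ.baseChange ℂ = φ.baseChange ℂ * Θ)
    (hΘskew : ∀ x y, ψ.form.baseChange ℂ (Θ x) y + ψ.form.baseChange ℂ x (Θ y) = 0)
    {y : Module.End ℚ V} (hyskew : ∀ v w, ψ.form (y v) w + ψ.form v (y w) = 0) (σ : ι → ℂ)
    (hσ : ∀ k, ∀ w ∈ Module.End.eigenspace (φ.baseChange ℂ) (μ k), y.baseChange ℂ w = σ k • w) :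
    LinearMap.trace ℂ _ (y.baseChange ℂ * Θ) =
      2 * ∑ k, σ k * ((Module.finrank ℂ ↥(Module.End.eigenspace (φ.baseChange ℂ) (μ k) ⊓ H.piece 1 0) : ℂ) -
        (Module.finrank ℂ ↥(Module.End.eigenspace (φ.baseChange ℂ) (μ k) ⊓ H.piece 0 1) : ℂ)) := by
  classical
  obtain ⟨cb, κ, hcbW, -, -, -, hdual, hiso⟩ :=
    CMTheta.exists_adaptedDualBasis H hn heff ψ hφE hE μ hinj hdist hrank htop
  have hfin : ∀ k, Module.finrank ℂ ↥(Module.End.eigenspace (φ.baseChange ℂ) (μ k)) = n₀ := fun k => by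
    rw [CMTheta.finrank_eigenspace_eq_add H hn heff hφE, hrank k]
  have hΘW : ∀ k, ∀ w ∈ Module.End.eigenspace (φ.baseChange ℂ) (μ k), Θ w ∈ Module.End.eigenspace (φ.baseChange ℂ) (μ k) :=
    fun k w hw => UnitaryTheta.apply_mem_eigenspace_of_commute hΘφ hw
  have he0 : ∀ k : ι, Function.Injective (fun j : Fin n₀ => (((k, (0 : Fin 2)), j) : (ι × Fin 2) × Fin n₀)) :=
    fun k j j' h => by simpa using h
  rw [CMArith.trace_mul_eq_two_mul_sum cb (ψ.form.baseChange ℂ) hdual hiso _ Θ σ (fun k j => hσ k _ (hcbW k j))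
    (CMThetaCentre.baseChange_skew H ψ hyskew) hΘskew (fun k j => hσ k _ (hΘW k _ (hcbW k j)))]
  congr 1
  refine Finset.sum_congr rfl fun k _ => ?_
  rw [← CMArith.trace_restrict_eq_sum_repr cb _ (he0 k) _ (hcbW k) (hfin k) Θ (hΘW k),
    CMArith.trace_restrict_theta H hn heff hΘ (hΘW k)]

/-! ### §4 CENTRE for two unbalanced places of equal weight, under «no Weil-type quadratic element» -/

/-- **CENTRE FOR THE PATTERNS WITH TWO UNBALANCED PLACES** (see the module docstring): `|ι| ≤ 3`, places `k₁ ≠ k₂` with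
`(dim W_{μ k₁}^{1,0} − dim W_{μ k₁}^{0,1})² = (dim W_{μ k₂}^{1,0} − dim W_{μ k₂}^{0,1})² ≠ 0`, every other place balanced,
and NO WEIL-TYPE QUADRATIC ELEMENT (`hnoWeil`: a non-zero `ψ`-skew `y ∈ E` with `y² ∈ ℚ·1` has `Tr(y_ℂ Θ) ≠ 0`). Then for
every `k` some `C ∈ 𝔤_ℂ` is `1` on `W_{μ k}` and `0` on the other `W_{μ j}`. Covers the cell's row 12 pattern `(2,2,1)` and
row 10 patterns `(2,2)`, `(2,1)` — exactly the members that are not of Weil type `(g/2, g/2)` for an imaginary quadratic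
`k ⊂ E`. [cite: MoonenZarhin1999LowDim, §2 (2.3)] [cite: Ribet1983, Thm. 0] -/
theorem CMThetaCentre.centre_of_pair [Module.Finite ℚ V] [HodgeTensorFacts.{u, u}] {ι : Type} [Fintype ι]
    [DecidableEq ι] (hι : Fintype.card ι ≤ 3)
    (H : HodgeStructure V n) (hn : n = 1) (heff : H.IsEffective) (ψ : H.Polarization)
    {φ : Module.End ℚ V} (hφE : φ ∈ H.endAlg) {m : ℕ} (hE : ∀ a ∈ H.endAlg, ∃ q : Fin m → ℚ, a = ∑ k, q k • φ ^ (k : ℕ))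
    (hEdim : Module.finrank ℚ H.endAlg = 2 * Fintype.card ι)
    (hdiv : ∀ a ∈ H.endAlg, a ≠ 0 → ∃ b : Module.End ℚ V, b * a = 1) (hφadj : ψ.adjoint φ ≠ φ)
    (μ : ι → ℂ) (hinj : Function.Injective μ) (hdist : ∀ k k', μ k' ≠ starRingEnd ℂ (μ k)) {n₀ : ℕ} (hn₀ : n₀ ≠ 0)
    (hrank : ∀ k, Module.finrank ℂ ↥(Module.End.eigenspace (φ.baseChange ℂ) (μ k) ⊓ H.piece 1 0) +
      Module.finrank ℂ ↥(Module.End.eigenspace (φ.baseChange ℂ) (μ k) ⊓ H.piece 0 1) = n₀)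
    (htop : (⨆ kt : ι × Fin 2, Module.End.eigenspace (φ.baseChange ℂ)
      (if kt.2 = 0 then μ kt.1 else starRingEnd ℂ (μ kt.1))) = ⊤)
    (𝔤 : Submodule ℚ (Module.End ℚ V))
    (hcomm : ∀ X ∈ 𝔤, ∀ a : H.endAlg, X * (a : Module.End ℚ V) = (a : Module.End ℚ V) * X)
    (hskew : ∀ X ∈ 𝔤, ∀ v w, ψ.form (X v) w + ψ.form v (X w) = 0)
    {Θ : Module.End ℂ (ℂ ⊗[ℚ] V)} (hΘ : ∀ p, ∀ x ∈ H.piece p (n - p), Θ x = ((2 * p - n : ℤ) : ℂ) • x)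
    (hΘ𝔤 : Θ ∈ spanC 𝔤)
    (hlift : ∀ k, ∀ Z : Module.End ℂ ↥(Module.End.eigenspace (φ.baseChange ℂ) (μ k)),
      LinearMap.trace ℂ _ Z = 0 → ∃ X ∈ spanC 𝔤,
        (∀ w : ↥(Module.End.eigenspace (φ.baseChange ℂ) (μ k)), X w = Z w) ∧
        ∀ j, j ≠ k → ∀ w ∈ Module.End.eigenspace (φ.baseChange ℂ) (μ j), X w = 0)
    (k₁ k₂ : ι) (hk : k₁ ≠ k₂)
    (hbal : ∀ k, k ≠ k₁ → k ≠ k₂ → Module.finrank ℂ ↥(Module.End.eigenspace (φ.baseChange ℂ) (μ k) ⊓ H.piece 1 0) =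
      Module.finrank ℂ ↥(Module.End.eigenspace (φ.baseChange ℂ) (μ k) ⊓ H.piece 0 1))
    (ht : ((Module.finrank ℂ ↥(Module.End.eigenspace (φ.baseChange ℂ) (μ k₁) ⊓ H.piece 1 0) : ℤ) -
        Module.finrank ℂ ↥(Module.End.eigenspace (φ.baseChange ℂ) (μ k₁) ⊓ H.piece 0 1)) ^ 2 =
      ((Module.finrank ℂ ↥(Module.End.eigenspace (φ.baseChange ℂ) (μ k₂) ⊓ H.piece 1 0) : ℤ) -
        Module.finrank ℂ ↥(Module.End.eigenspace (φ.baseChange ℂ) (μ k₂) ⊓ H.piece 0 1)) ^ 2)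
    (ht0 : Module.finrank ℂ ↥(Module.End.eigenspace (φ.baseChange ℂ) (μ k₂) ⊓ H.piece 1 0) ≠
      Module.finrank ℂ ↥(Module.End.eigenspace (φ.baseChange ℂ) (μ k₂) ⊓ H.piece 0 1))
    (hnoWeil : ∀ y ∈ H.endAlg, y ≠ 0 → (∀ v w, ψ.form (y v) w + ψ.form v (y w) = 0) →
      (∃ q : ℚ, y * y = q • 1) → LinearMap.trace ℂ _ (y.baseChange ℂ * Θ) ≠ 0) :
    ∀ k, ∃ C ∈ spanC 𝔤, (∀ w ∈ Module.End.eigenspace (φ.baseChange ℂ) (μ k), C w = w) ∧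
      ∀ j, j ≠ k → ∀ w ∈ Module.End.eigenspace (φ.baseChange ℂ) (μ j), C w = 0 := by
  classical
  rcases CMThetaCentre.centre_or_exists_skew H hn heff ψ hφE hE hEdim hdiv hφadj μ hinj hdist hn₀ hrank htop 𝔤 hcomm
    hskew hΘ hΘ𝔤 hlift with h | ⟨y, hyE, hy0, hyskew, σ, hσ, hsum⟩
  · exact h
  exfalso
  haveI : Module.Free ℚ V := Module.Free.of_divisionRing ℚ V
  set F := φ.baseChange ℂ with hF
  -- notation for the weights `t k = dim W^{1,0} − dim W^{0,1}`
  set t : ι → ℂ := fun k => ((Module.finrank ℂ ↥(Module.End.eigenspace F (μ k) ⊓ H.piece 1 0) : ℂ) -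
    (Module.finrank ℂ ↥(Module.End.eigenspace F (μ k) ⊓ H.piece 0 1) : ℂ)) with htdef
  have hsum' : ∑ k, σ k * t k = 0 := hsum
  have htk : ∀ k, k ≠ k₁ → k ≠ k₂ → t k = 0 := fun k h1 h2 => by
    simp only [htdef, hbal k h1 h2, sub_self]
  have ht' : t k₁ ^ 2 = t k₂ ^ 2 := by
    have h := congrArg (fun z : ℤ => (z : ℂ)) ht
    simpa [htdef] using h
  have ht0' : t k₂ ≠ 0 := by
    simp only [htdef, sub_ne_zero, Ne, Nat.cast_inj]; exact ht0
  -- the relation `σ k₁ t k₁ + σ k₂ t k₂ = 0`, hence `σ k₂ ² = σ k₁ ²`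
  have hrel : σ k₁ * t k₁ + σ k₂ * t k₂ = 0 := by
    rw [← hsum', Finset.sum_eq_add k₁ k₂ hk (fun k _ hk' => by rw [htk k hk'.1 hk'.2, mul_zero])
      (fun h => absurd (Finset.mem_univ k₁) h) (fun h => absurd (Finset.mem_univ k₂) h)]
  have hσσ : σ k₂ ^ 2 = σ k₁ ^ 2 := by
    have h1 : (σ k₂ * t k₂) ^ 2 = (σ k₁ * t k₁) ^ 2 := by
      rw [show σ k₂ * t k₂ = -(σ k₁ * t k₁) from eq_neg_of_add_eq_zero_right hrel, neg_sq]
    rw [mul_pow, mul_pow, ht'] at h1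
    exact mul_right_cancel₀ (pow_ne_zero 2 ht0') h1
  -- `Θ` and `y_ℂ` commute with `φ_ℂ`; `Θ` is skew
  have hΘφ : Θ * F = F * Θ := UnitaryTheta.commute_of_mem_spanC H hφE hcomm hΘ𝔤
  have hΘskew := ThetaSubalgebra.formBaseChange_add_eq_zero_of_mem_spanC ψ hskew hΘ𝔤
  have hEcomm : ∀ a ∈ H.endAlg, ∀ b ∈ H.endAlg, a * b = b * a := fun a ha b hb =>
    CMThetaCentre.mul_comm_of_hE H hE ha hb
  have hyφ : y.baseChange ℂ * F = F * y.baseChange ℂ := by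
    rw [hF, ← LinearMap.baseChange_mul, hEcomm y hyE φ hφE, LinearMap.baseChange_mul]
  have hyskewC := CMThetaCentre.baseChange_skew H ψ hyskew
  -- `Tr(y_ℂ Θ) = 2 Σ σ_k t_k = 0`
  have htr0 : LinearMap.trace ℂ _ (y.baseChange ℂ * Θ) = 0 := by
    rw [CMThetaCentre.trace_baseChange_mul_theta H hn heff ψ hφE hE μ hinj hdist hrank htop hΘ hΘφ hΘskew hyskew σ hσ]
    change 2 * ∑ k, σ k * t k = 0
    rw [hsum', mul_zero]
  refine hnoWeil y hyE hy0 hyskew ?_ htr0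
  -- IT REMAINS: `y² ∈ ℚ · 1`. The adapted dual basis; `y_ℂ` is `σ k` on the `(k,0)`- and `−σ k` on the `(k,1)`-vectors
  obtain ⟨cb, κ, hcbW, hcbW', -, -, hdual, hiso⟩ :=
    CMTheta.exists_adaptedDualBasis H hn heff ψ hφE hE μ hinj hdist hrank htop
  have hfin : ∀ k, Module.finrank ℂ ↥(Module.End.eigenspace F (μ k)) = n₀ := fun k => by
    rw [hF, CMTheta.finrank_eigenspace_eq_add H hn heff hφE, hrank k]
  have hfin' : ∀ k, Module.finrank ℂ ↥(Module.End.eigenspace F (starRingEnd ℂ (μ k))) = n₀ := fun k => by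
    rw [← hfin k, hF, ← finrank_eigenspace_baseChange_conj_eq starRingAut φ (μ k), starRingAut_apply,
      starRingEnd_apply]
  have he1 : ∀ k : ι, Function.Injective (fun j : Fin n₀ => (((k, (1 : Fin 2)), j) : (ι × Fin 2) × Fin n₀)) :=
    fun k j j' h => by simpa using h
  have hW'span : ∀ k, Module.End.eigenspace F (starRingEnd ℂ (μ k)) =
      Submodule.span ℂ (Set.range (cb ∘ fun j : Fin n₀ => ((k, (1 : Fin 2)), j))) :=
    fun k => CMArith.eq_span_of_basis cb _ (he1 k) _ (hcbW' k) (hfin' k)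
  have hy0v : ∀ k j, y.baseChange ℂ (cb ((k, 0), j)) = σ k • cb ((k, 0), j) := fun k j => hσ k _ (hcbW k j)
  have hy1v : ∀ k j, y.baseChange ℂ (cb ((k, 1), j)) = -(σ k • cb ((k, 1), j)) :=
    CMArith.apply_eq_neg_smul_of_skew cb (ψ.form.baseChange ℂ) hdual hiso _ σ hy0v hyskewC (fun k j => by
      rw [← hW'span k]
      exact UnitaryTheta.apply_mem_eigenspace_of_commute hyφ (hcbW' k j))
  -- `u = y²` acts on `cb (kt, j)` by `σ kt.1 ²`
  have huE : y * y ∈ H.endAlg := H.endAlg.mul_mem hyE hyE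
  set s : (ι × Fin 2) × Fin n₀ → ℂ := fun i => σ i.1.1 ^ 2 with hsdef
  have hu : ∀ i, (y * y).baseChange ℂ (cb i) = s i • cb i := by
    rintro ⟨⟨k, r⟩, j⟩
    rw [LinearMap.baseChange_mul, Module.End.mul_apply]
    rcases Fin.exists_fin_two.1 ⟨r, rfl⟩ with h | h <;> rw [h]
    · rw [hy0v, map_smul, hy0v, smul_smul]
      simp only [hsdef, sq]
    · rw [hy1v, map_neg, map_smul, hy1v, smul_neg, neg_neg, smul_smul]
      simp only [hsdef, sq]
  -- all the values `σ k ²` coincide with `a = σ k₁ ²`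
  set a := σ k₁ ^ 2 with hadef
  have hall : ∀ k, σ k ^ 2 = a := by
    intro k
    by_cases h1 : k = k₁
    · rw [h1]
    by_cases h2 : k = k₂
    · rw [h2, hσσ]
    by_contra hka
    -- `ι = {k₁, k₂, k}`
    have huniv : ∀ k', k' = k₁ ∨ k' = k₂ ∨ k' = k := by
      have h3 : ({k₁, k₂, k} : Finset ι) = Finset.univ := by
        apply Finset.eq_of_subset_of_card_le (Finset.subset_univ _)
        rw [Finset.card_univ, Finset.card_insert_of_notMem (by simp [hk, Ne.symm h1]),
          Finset.card_insert_of_notMem (by simp [Ne.symm h2]), Finset.card_singleton]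
        exact hι
      intro k'
      have hk' : k' ∈ ({k₁, k₂, k} : Finset ι) := by rw [h3]; exact Finset.mem_univ _
      simpa using hk'
    have hval : ∀ k', σ k' ^ 2 = a ∨ σ k' ^ 2 = σ k ^ 2 := fun k' => by
      rcases huniv k' with rfl | rfl | rfl
      · exact Or.inl rfl
      · exact Or.inl hσσ
      · exact Or.inr rfl
    -- the two values have multiplicities `2n₀(|ι| − 1) = 4n₀` and `2n₀`: unbalanced
    have hiff : ∀ i : (ι × Fin 2) × Fin n₀, s i = σ k ^ 2 ↔ i.1.1 = k := fun i => by
      constructor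
      · intro h
        by_contra hne
        rcases huniv i.1.1 with e | e | e
        · exact hka (by rw [hsdef] at h; simp only at h; rw [e] at h; exact h.symm)
        · exact hka (by rw [hsdef] at h; simp only at h; rw [e, hσσ] at h; exact h.symm)
        · exact hne e
      · intro h; rw [hsdef]; simp only; rw [h]
    have hcountc : (Finset.univ.filter fun i : (ι × Fin 2) × Fin n₀ => s i = σ k ^ 2).card = 2 * n₀ := by
      have hset : (Finset.univ.filter fun i : (ι × Fin 2) × Fin n₀ => s i = σ k ^ 2) =
          (({k} : Finset ι) ×ˢ (Finset.univ : Finset (Fin 2))) ×ˢ (Finset.univ : Finset (Fin n₀)) := by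
        ext ⟨⟨k', r⟩, j⟩
        simp only [Finset.mem_filter, Finset.mem_univ, true_and, Finset.mem_product, Finset.mem_singleton, and_true]
        exact hiff ((k', r), j)
      rw [hset, Finset.card_product, Finset.card_product, Finset.card_singleton, Finset.card_univ, Finset.card_univ,
        Fintype.card_fin, Fintype.card_fin, one_mul]
    have htot : (Finset.univ.filter fun i : (ι × Fin 2) × Fin n₀ => s i = a).card +
        (Finset.univ.filter fun i : (ι × Fin 2) × Fin n₀ => s i = σ k ^ 2).card = Fintype.card ι * 2 * n₀ := by
      have hneg : (Finset.univ.filter fun i : (ι × Fin 2) × Fin n₀ => s i = σ k ^ 2) =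
          Finset.univ.filter fun i : (ι × Fin 2) × Fin n₀ => ¬ s i = a := by
        ext i
        simp only [Finset.mem_filter, Finset.mem_univ, true_and]
        constructor
        · intro h h'; exact hka (h.symm.trans h')
        · intro h
          rcases hval i.1.1 with e | e
          · exact absurd (by rw [hsdef]; exact e) h
          · rw [hsdef]; exact e
      rw [hneg, Finset.card_filter_add_card_filter_not, Finset.card_univ, Fintype.card_prod,
        Fintype.card_prod, Fintype.card_fin, Fintype.card_fin]
    have hcard3 : Fintype.card ι = 3 := by
      apply le_antisymm hι
      have h := Finset.card_le_univ ({k₁, k₂, k} : Finset ι)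
      rwa [Finset.card_insert_of_notMem (by simp [hk, Ne.symm h1]), Finset.card_insert_of_notMem (by simp [Ne.symm h2]),
        Finset.card_singleton] at h
    refine CMArith.false_of_two_eigenvalues H hdiv huE cb s hu (a := a) (c := σ k ^ 2) (Ne.symm hka)
      (fun i => hval i.1.1) ?_ ⟨((k₁, 0), ⟨0, Nat.pos_of_ne_zero hn₀⟩), rfl⟩
      ⟨((k, 0), ⟨0, Nat.pos_of_ne_zero hn₀⟩), rfl⟩
    intro hc
    rw [hc, hcountc, hcard3] at htot
    omega
  -- hence `(y²)_ℂ = a · 1` with `a = Tr_ℚ(y²) / (2|ι|n₀) ∈ ℚ`, and `y² = q · 1`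
  have hua : ∀ i, (y * y).baseChange ℂ (cb i) = a • cb i := fun i => by rw [hu, hsdef]; simp only; rw [hall]
  have hcardpos : (Fintype.card ((ι × Fin 2) × Fin n₀) : ℂ) ≠ 0 := by
    have h0 : 0 < Fintype.card ι := Fintype.card_pos_iff.2 ⟨k₁⟩
    rw [Fintype.card_prod, Fintype.card_prod, Fintype.card_fin, Fintype.card_fin]
    exact_mod_cast (Nat.mul_pos (Nat.mul_pos h0 two_pos) (Nat.pos_of_ne_zero hn₀)).ne'
  have htr : ((LinearMap.trace ℚ V (y * y) : ℚ) : ℂ) = Fintype.card ((ι × Fin 2) × Fin n₀) * a := by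
    rw [← eq_ratCast (algebraMap ℚ ℂ), ← LinearMap.trace_baseChange,
      CMArith.trace_eq_sum_of_apply_basis cb _ (fun _ => a) hua, Finset.sum_const, Finset.card_univ, nsmul_eq_mul]
  set q : ℚ := LinearMap.trace ℚ V (y * y) / Fintype.card ((ι × Fin 2) × Fin n₀) with hqdef
  have haq : a = (q : ℂ) := by
    rw [hqdef, Rat.cast_div, Rat.cast_natCast, htr, mul_div_cancel_left₀ _ hcardpos]
  exact ⟨q, CMArith.eq_smul_one_of_apply_eq_smul H hdiv huE (cb.ne_zero ((k₁, 0), ⟨0, Nat.pos_of_ne_zero hn₀⟩))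
    (by rw [hua, haq])⟩

end HodgeStructure

end Literature.AlgebraicGeometry.Motives
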